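import Literature.NumberTheory.LFunctions.BurnolZetaSystems
import Literature.NumberTheory.ConnesConsani2021.ProlateProjections
import Literature.NumberTheory.Weil1964.AdelicSecondDegreeCharacter
import Literature.Analysis.DeBrangesSpaces.Basic
import Mathlib.Analysis.Distribution.TemperedDistribution
import HarnessLib

/-!
# Burnol 2002 (CRAS 335): the Sonine spaces `K_λ`, the orthogonal projection onto `K_λ`, the Sonine
# distributions `A_λ`, `−iB_λ`, and the explicit structure function `ℰ_λ` with `ℬ(ℰ_λ) = 𝒮_λ`
# (statements as printed)

LABEL (line 1): **RH-FREE** — typed statements of the PRINTED results of J.-F. Burnol, *Sur les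
« espaces de Sonine » associés par de Branges à la transformation de Fourier*, C. R. Math. Acad. Sci.
Paris **335** (2002) 689–692 = arXiv:math/0208121 [Burnol2002CRAS] (TeX of record
`dbl/src/Burnol2002CRAS_arXivmath0208121.tex`, one running counter: Théorème 1 (cited from [5]),
Lemme 2, Lemme 3, Théorème 4, Corollaire 5, Définition 1, Théorème 6, Définition 2, Théorème 7,
Théorème 8, Théorème 9; statement lines `TeX l.nnn`). Pure Fourier analysis of the Sonine spaces (no
zeta function at all). bears_on: LADDER-RH COLUMN 6 (DBR: de Branges framework), B-C. WHAT THIS IS NOT: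
not a route, not an RH criterion, no positivity condition at `E_ζ`; nothing here bears on the truth of
RH.

## Dictionary (Note ↦ tree; nothing re-declared)

* `L²(ℝ)^{pair}` with `‖f‖² = ∫₀^∞ |f|²` (TeX l.262–264) ↦ even classes of `Lp ℂ 2 volume`
  (`Literature.NumberTheory.LFunctions.evenL2`); Burnol's norm is HALF the `L²(ℝ)` norm (bookkept where
  it matters: Thm. 8). `𝓕(φ)(x) = ∫ e^{2πixy} φ(y) dy` (TeX l.174), `= 𝓕₊` (cosine) on even functions ↦
  Mathlib's unitary `𝓕` on `Lp ℂ 2` (kernel `e^{−2πixy}`: the same operator on even classes), as the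
  bounded operator `fourierL2`.
* `P_λ` (projection onto `L²(−λ,λ)`), `P̃_λ = 𝓕 P_λ 𝓕* = 𝓕₊ P_λ 𝓕₊` (TeX l.259–266) ↦ Connes–Consani's
  `Literature.NumberTheory.ConnesConsani2021.cutoffProj λ`, `cutoffProjHat λ` (`= 𝓕⁻¹ P_λ 𝓕`; on even
  classes `𝓕⁻¹ = 𝓕`).
* `K_λ` (even square-integrable Sonine functions, TeX l.211–213) ↦
  `Literature.NumberTheory.LFunctions.sonineK λ`; the orthogonal projection `π_λ` onto `K_λ` (Thm. 4) ↦
  `Literature.NumberTheory.ConnesConsani2021.soninProjection λ λ` (CC's `S(λ,λ) = K_λ` a.e.; for an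
  even `f` the projection computed in `L²(ℝ)` or in `L²(ℝ)^{pair}` is the same vector).
* `G_λ = P_λ(L²^{pair}) + P̃_λ(L²^{pair})` ↦ `Gspace λ`; `F_λ = P_λ 𝓕₊ P_λ`, `D_λ = F_λ²` (TeX l.279–285)
  ↦ `slepianF λ`, `slepianD λ`; `(1 ± F_λ)^{-1}`, `(1 − D_λ)^{-1}` ↦ `Ring.inverse` in the operator ring
  (the genuine inverse when it exists — the facts assert `IsUnit`).
* the even prolate spheroidal functions `e_{2n}` ([slepian], TeX l.285–287) ↦ the tree's
  `Literature.NumberTheory.LFunctions.IsProlateFunction λ (2n)` (existence and uniqueness PROVED there).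
* `P_λ(2cos(2πλy))` ↦ `cosCut λ`; `ψ_±^λ` (Déf. 2) ↦ `psiPlus λ`, `psiMinus λ` (functions on `ℂ`; the
  printed `𝓕₊` of the `L²(−λ,λ)` function `h_± = (1 ± F_λ)^{-1} P_λ(2cos 2πλy)` is written as the
  absolutely convergent `∫_{−λ}^{λ} h_±(y) e^{2πity} dy`).
* the tempered distributions `A_λ`, `−iB_λ` (Déf. 1) ↦ `distA λ`, `distNegIB λ` : `𝓢'(ℝ, ℂ)` (Mathlib
  tempered distributions: `delta`, `Lp.toTemperedDistribution`, temperate-growth functions; `2cos(2πλt)`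
  is entered as `𝐞(λt) + 𝐞(−λt)`, `twoCos_eq`).
* `𝒮_λ = {π^{−w/2}Γ(w/2) f̂(w) : f ∈ K_λ}`, `f̂(w) = ∫₀^∞ f(t) t^{−w} dt` (TeX l.201–206, 236–238: right
  Mellin, as in Burnol 2004) ↦ `IsCompletedRightMellin f M` (the ENTIRE `M` agreeing with
  `Γ_ℝ(w)·∫₀^∞ f t^{−w}` on `Re w > 1/2`, where the integral converges absolutely for `f ∈ K_λ` and `Γ_ℝ`
  has no pole); the euclidean evaluator `Z_w^λ = π^{−w/2}Γ(w/2) X_w^λ ∈ K_λ` (Thm. 9; TeX l.401–404) ↦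
  `IsSonineZ λ w Z` (= Burnol 2004's `Z^λ_{w,0}`, `Literature.NumberTheory.LFunctions.IsBurnolZ λ w 0`,
  off the junk locus of that file's `completedMellin`).
* de Branges spaces "par rapport à la droite critique" `L = 1/2 + iℝ`, `L_+ = {Re s > 1/2}`,
  `w^# = 1 − w̄` (§1, TeX l.126–150) ↦ the tree's upper-half-plane vocabulary
  (`Literature.Analysis.DeBrangesSpaces.IsHermiteBiehler`, `HasKernelBound`, `deBrangesNormSq`) after the
  change of variable `s = 1/2 − iz` (`Im z > 0 ↔ Re s > 1/2`, `z̄ ↔ s^#`, Lebesgue measure on `ℝ` ↔ `|ds|`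
  on `L`): `toUpperHalfPlane`.

NOT typed: Théorème 1 (TeX l.229–238) is a citation of Burnol's co-Poisson paper [5] about tempered
DISTRIBUTIONS with the Sonine property and their Mellin transforms (no new statement of this Note); the
Remarque (TeX l.300–305); the proof sketch of Thm. 8 (TeX l.398–421).

## References
* [Burnol2002CRAS] C. R. Math. Acad. Sci. Paris 335 (2002) 689–692, doi:10.1016/s1631-073x(02)02546-3
  = arXiv:math/0208121 (TeX read).
* [ConnesConsani2021] §4 (`P_Λ`, `P̂_Λ`, Sonin space and its projection — tree files
  `ProlateProjections.lean`, `SoninProjection.lean`).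
* [Burnol2004b] (tree `BurnolZetaSystems.lean`: `K_a`, evaluators).
-/

noncomputable section

open _root_.MeasureTheory _root_.Complex _root_.Set _root_.Filter
open scoped Real Topology FourierTransform ComplexConjugate SchwartzMap
open Literature.NumberTheory.LFunctions (evenL2 sonineK IsProlateFunction)
open Literature.NumberTheory.ConnesConsani2021 (cutoffProj cutoffProjHat soninProjection)

namespace Literature.Analysis.DeBrangesSpaces

namespace Burnol2002

/-! ## The operators `𝓕₊`, `F_λ`, `D_λ`, `P_λ + P̃_λ` and the space `G_λ` (§3, TeX l.259–285) -/

/-- RH-FREE (definition). Mathlib's unitary `L²(ℝ)` Fourier transform as a bounded operator; on even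
classes it is Burnol's cosine transform `𝓕₊` (and `𝓕`, kernel `e^{+2πixy}`, TeX l.174).
[cite: Burnol2002CRAS, §2 (TeX l.174, 207–210)] -/
def fourierL2 : Lp ℂ 2 (volume : Measure ℝ) →L[ℂ] Lp ℂ 2 (volume : Measure ℝ) :=
  ((Lp.fourierTransformₗᵢ ℝ ℂ).toContinuousLinearEquiv :
    Lp ℂ 2 (volume : Measure ℝ) →L[ℂ] Lp ℂ 2 (volume : Measure ℝ))

/-- `fourierL2 f = 𝓕 f`. [cite: Burnol2002CRAS, §2 (TeX l.207–210)] -/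
theorem fourierL2_apply (f : Lp ℂ 2 (volume : Measure ℝ)) :
    fourierL2 f = (𝓕 f : Lp ℂ 2 (volume : Measure ℝ)) := rfl

/-- RH-FREE (definition). **`F_λ = P_λ 𝓕₊ P_λ`** (TeX l.279–281: "compact auto-adjoint de norme
strictement inférieure à `1`"). [cite: Burnol2002CRAS, Lemme 2, proof (TeX l.279–281)] -/
def slepianF (lam : ℝ) : Lp ℂ 2 (volume : Measure ℝ) →L[ℂ] Lp ℂ 2 (volume : Measure ℝ) :=
  (cutoffProj lam).comp (fourierL2.comp (cutoffProj lam))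

/-- RH-FREE (definition). **`D_λ = F_λ²`** (TeX l.283–285; on `L²(−λ,λ)^{pair}` it is the kernel
`sin(2πλ(x−y))/π(x−y)`, Thm. 4). [cite: Burnol2002CRAS, Lemme 2, proof (TeX l.283–285)] -/
def slepianD (lam : ℝ) : Lp ℂ 2 (volume : Measure ℝ) →L[ℂ] Lp ℂ 2 (volume : Measure ℝ) :=
  (slepianF lam).comp (slepianF lam)

/-- RH-FREE (definition). The operator **`P_λ + P̃_λ`** of Lemme 2 (TeX l.268–274).
[cite: Burnol2002CRAS, Lemme 2 (TeX l.268–274)] -/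
def sumProj (lam : ℝ) : Lp ℂ 2 (volume : Measure ℝ) →L[ℂ] Lp ℂ 2 (volume : Measure ℝ) :=
  cutoffProj lam + cutoffProjHat lam

/-- RH-FREE (definition). **`G_λ = P_λ(L²(ℝ)^{pair}) + P̃_λ(L²(ℝ)^{pair})`** (TeX l.265–266), as a set
of classes. [cite: Burnol2002CRAS, §3 (TeX l.265–266)] -/
def Gspace (lam : ℝ) : Set (Lp ℂ 2 (volume : Measure ℝ)) :=
  {k | ∃ u v : Lp ℂ 2 (volume : Measure ℝ), u ∈ evenL2 ∧ v ∈ evenL2 ∧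
    k = cutoffProj lam u + cutoffProjHat lam v}

/-- RH-FREE. **Lemme 2** (TeX l.268–274), verbatim: *L'espace de Sonine `K_λ` est le noyau de
l'opérateur `P_λ + P̃_λ` (sur `L²(ℝ)^{pair}`). La restriction de cet opérateur à `G_λ` est auto-adjoint
et de Fredholm (i.e. de la forme `1 +` compact) et est inversible. La projection orthogonale de
`f ∈ L²(ℝ)^{pair}` sur `G_λ` est `(P_λ + P̃_λ)^{-1}(P_λ(f) + P̃_λ(f))`.* Typed (λ > 0): (i) for even `f`,
`f ∈ K_λ ↔ (P_λ + P̃_λ) f = 0`; (ii) invertibility on `G_λ`: for every even `f` there is a unique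
`k ∈ G_λ` with `(P_λ + P̃_λ)k = (P_λ + P̃_λ)f`; (iii) that `k` is the orthogonal projection of `f` onto
`G_λ`: `f − k ∈ K_λ` and `f − k ⊥ G_λ` (printed proof TeX l.276–278). The descriptors "auto-adjoint,
Fredholm `1 +` compact" are not restated (TODO(general form)). [cite: Burnol2002CRAS, Lemme 2 (TeX l.268–274)] -/
def Burnol2002CRAS_lem2 : Prop :=
  ∀ lam : ℝ, 0 < lam →
    (∀ f : Lp ℂ 2 (volume : Measure ℝ), f ∈ evenL2 → (f ∈ sonineK lam ↔ sumProj lam f = 0)) ∧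
    (∀ f : Lp ℂ 2 (volume : Measure ℝ), f ∈ evenL2 →
      ∃! k : Lp ℂ 2 (volume : Measure ℝ), k ∈ Gspace lam ∧ sumProj lam k = sumProj lam f) ∧
    (∀ f : Lp ℂ 2 (volume : Measure ℝ), f ∈ evenL2 → ∀ k ∈ Gspace lam,
      sumProj lam k = sumProj lam f →
        f - k ∈ sonineK lam ∧ ∀ g ∈ Gspace lam, inner ℂ (f - k) g = 0)

/-- RH-FREE. **Lemme 3** (TeX l.289–293), verbatim: *Les vecteurs propres de l'opérateur (dans `G_λ`) de
Fredholm `P_λ + P̃_λ` sont les vecteurs `e_{2n} ± 𝓕₊(e_{2n})`, `n ∈ ℕ`. Ils forment une base orthogonale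
de `G_λ` puisque l'opérateur est auto-adjoint.* (`e_{2n}` = the even prolate spheroidal functions,
[slepian]; TeX l.285–287: "`F_λ` a les mêmes vecteurs propres que `D_λ`".) Typed over the tree's
`IsProlateFunction λ (2n)` and any `L²` class `E` of `e_{2n}`: (i) `E ± 𝓕E ∈ G_λ` are eigenvectors of
`P_λ + P̃_λ`; (ii) every eigenvector of `P_λ + P̃_λ` lying in `G_λ` is a scalar multiple of one of them;
(iii) they are pairwise orthogonal and their span is dense in `G_λ`.
[cite: Burnol2002CRAS, Lemme 3 (TeX l.289–293)] -/
def Burnol2002CRAS_lem3 : Prop :=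
  ∀ lam : ℝ, 0 < lam →
    (∀ (n : ℕ) (e : ℝ → ℝ) (E : Lp ℂ 2 (volume : Measure ℝ)), IsProlateFunction lam (2 * n) e →
      (∀ᵐ x : ℝ, E x = (e x : ℂ)) →
        (E + fourierL2 E ∈ Gspace lam ∧ E + fourierL2 E ≠ 0 ∧
          ∃ μ : ℂ, sumProj lam (E + fourierL2 E) = μ • (E + fourierL2 E)) ∧
        (E - fourierL2 E ∈ Gspace lam ∧ E - fourierL2 E ≠ 0 ∧
          ∃ μ : ℂ, sumProj lam (E - fourierL2 E) = μ • (E - fourierL2 E))) ∧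
    (∀ v ∈ Gspace lam, v ≠ 0 → (∃ μ : ℂ, sumProj lam v = μ • v) →
      ∃ (n : ℕ) (e : ℝ → ℝ) (E : Lp ℂ 2 (volume : Measure ℝ)) (c : ℂ),
        IsProlateFunction lam (2 * n) e ∧ (∀ᵐ x : ℝ, E x = (e x : ℂ)) ∧
          (v = c • (E + fourierL2 E) ∨ v = c • (E - fourierL2 E))) ∧
    (∀ (S : Set (Lp ℂ 2 (volume : Measure ℝ))),
      S = {v | ∃ (n : ℕ) (e : ℝ → ℝ) (E : Lp ℂ 2 (volume : Measure ℝ)),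
            IsProlateFunction lam (2 * n) e ∧ (∀ᵐ x : ℝ, E x = (e x : ℂ)) ∧
            (v = E + fourierL2 E ∨ v = E - fourierL2 E)} →
        (∀ v ∈ S, ∀ v' ∈ S, v ≠ v' → inner ℂ v v' = 0) ∧
        Gspace lam ⊆ closure (Submodule.span ℂ S : Set (Lp ℂ 2 (volume : Measure ℝ))))

/-- RH-FREE. **Théorème 4** (TeX l.310–319), verbatim: *Soit `f(x)` une fonction paire de carré
intégrable. Sa projection orthogonale sur l'espace de Sonine `K_λ` est donnée par la formule
`π_λ(f) = f − (1 − D_λ)^{-1}(P_λ(f) − F_λ 𝓕₊(f)) − 𝓕₊(1 − D_λ)^{-1}(P_λ 𝓕₊(f) − F_λ(f))`.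
On a `F_λ = P_λ 𝓕₊ P_λ` et `D_λ = F_λ²` agissant sur `L²(−λ,λ)^{pair}`. On peut remplacer `D_λ` par le
noyau `sin(2πλ(x−y))/π(x−y)` restreint à `L²(−λ,λ)^{pair}`.* Typed with `π_λ = soninProjection λ λ`
and `(1 − D_λ)^{-1} = Ring.inverse (1 − D_λ)` together with `IsUnit (1 − D_λ)` (the kernel remark is not
restated). [cite: Burnol2002CRAS, Théorème 4 (TeX l.310–319)] -/
def Burnol2002CRAS_thm4 : Prop :=
  ∀ lam : ℝ, 0 < lam →
    IsUnit (1 - slepianD lam) ∧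
    ∀ f : Lp ℂ 2 (volume : Measure ℝ), f ∈ evenL2 →
      soninProjection lam lam f =
        f - Ring.inverse (1 - slepianD lam) (cutoffProj lam f - slepianF lam (fourierL2 f)) -
          fourierL2 (Ring.inverse (1 - slepianD lam)
            (cutoffProj lam (fourierL2 f) - slepianF lam f))

/-- RH-FREE. **Corollaire 5** (TeX l.321–333), verbatim: *Si `f|_{(−λ,λ)} = 0` alors
`π_λ(f) = f|_{|t|>λ} − (𝓕₊(1 − D_λ)^{-1} P_λ 𝓕₊(f))|_{|t|>λ}`. Si `f = 𝓕₊(f)` alors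
`π_λ(f) = f − (1 + 𝓕₊)(1 + F_λ)^{-1} P_λ(f)`. Si `f = −𝓕₊(f)` alors
`π_λ(f) = f − (1 − 𝓕₊)(1 − F_λ)^{-1} P_λ(f)`.* (`f` even square-integrable; `g|_{|t|>λ} = (1 − P_λ)g`.)
[cite: Burnol2002CRAS, Corollaire 5 (TeX l.321–333)] -/
def Burnol2002CRAS_cor5 : Prop :=
  ∀ lam : ℝ, 0 < lam → ∀ f : Lp ℂ 2 (volume : Measure ℝ), f ∈ evenL2 →
    (cutoffProj lam f = 0 →
      soninProjection lam lam f =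
        (f - cutoffProj lam f) -
          (fourierL2 (Ring.inverse (1 - slepianD lam) (cutoffProj lam (fourierL2 f))) -
            cutoffProj lam
              (fourierL2 (Ring.inverse (1 - slepianD lam) (cutoffProj lam (fourierL2 f)))))) ∧
    (fourierL2 f = f →
      soninProjection lam lam f =
        f - (Ring.inverse (1 + slepianF lam) (cutoffProj lam f) +
          fourierL2 (Ring.inverse (1 + slepianF lam) (cutoffProj lam f)))) ∧
    (fourierL2 f = -f →
      soninProjection lam lam f =
        f - (Ring.inverse (1 - slepianF lam) (cutoffProj lam f) -
          fourierL2 (Ring.inverse (1 - slepianF lam) (cutoffProj lam f))))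

/-! ## `P_λ(2cos(2πλy))`, the functions `ψ_±^λ` and the distributions `A_λ`, `−iB_λ` (§4) -/

/-- RH-FREE (definition). The function `2cos(2πλy)` (complex-valued). [cite: Burnol2002CRAS, Définition 1 (TeX l.346–352)] -/
def twoCos (lam : ℝ) (y : ℝ) : ℂ :=
  2 * (Real.cos (2 * π * lam * y) : ℂ)

/-- `2cos(2πλy)` is continuous. [cite: Burnol2002CRAS, Définition 1 (TeX l.346–352)] -/
theorem continuous_twoCos (lam : ℝ) : Continuous (twoCos lam) :=
  continuous_const.mul
    (Complex.continuous_ofReal.comp (Real.continuous_cos.comp (continuous_const.mul continuous_id)))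

/-- `‖2cos(2πλy)‖ ≤ 2`. [cite: Burnol2002CRAS, Définition 1 (TeX l.346–352)] -/
theorem norm_twoCos_le (lam y : ℝ) : ‖twoCos lam y‖ ≤ 2 := by
  unfold twoCos
  rw [norm_mul, Complex.norm_real, Real.norm_eq_abs]
  have h := Real.abs_cos_le_one (2 * π * lam * y)
  have h2 : ‖(2 : ℂ)‖ = 2 := by simp
  rw [h2]
  nlinarith

/-- `𝟙_{[−λ,λ]} · 2cos(2πλy)` is square integrable (bounded on a set of finite measure).
[cite: Burnol2002CRAS, Définition 1 (TeX l.346–352)] -/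
theorem memLp_indicator_twoCos (lam : ℝ) :
    MemLp ((Icc (-lam) lam).indicator (twoCos lam)) 2 (volume : Measure ℝ) := by
  rw [memLp_indicator_iff_restrict measurableSet_Icc]
  exact MemLp.of_bound (continuous_twoCos lam).aestronglyMeasurable 2
    (Eventually.of_forall (norm_twoCos_le lam))

/-- RH-FREE (definition). **`P_λ(2cos(2πλy))`** as an `L²(ℝ)` class (TeX l.349, 363).
[cite: Burnol2002CRAS, Définition 1 (TeX l.346–352)] -/
def cosCut (lam : ℝ) : Lp ℂ 2 (volume : Measure ℝ) :=
  (memLp_indicator_twoCos lam).toLp _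

/-- RH-FREE (definition). **`h_+^λ = (1 + F_λ)^{-1} P_λ(2cos(2πλy))`** (inside Déf. 1/2, TeX l.349, 363).
[cite: Burnol2002CRAS, Définition 2 (TeX l.361–367)] -/
def hPlus (lam : ℝ) : Lp ℂ 2 (volume : Measure ℝ) :=
  Ring.inverse (1 + slepianF lam) (cosCut lam)

/-- RH-FREE (definition). **`h_−^λ = (1 − F_λ)^{-1} P_λ(2cos(2πλy))`** (TeX l.351, 366).
[cite: Burnol2002CRAS, Définition 2 (TeX l.361–367)] -/
def hMinus (lam : ℝ) : Lp ℂ 2 (volume : Measure ℝ) :=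
  Ring.inverse (1 - slepianF lam) (cosCut lam)

/-- RH-FREE (definition). **Définition 2, `ψ_+^λ(t) = 2cos(2πλt) − 𝓕₊((1+F_λ)^{-1}P_λ(2cos 2πλy))(t)`**
(TeX l.361–364), as a function on `ℂ`, the cosine transform of the `L²(−λ,λ)` class `h_+^λ` written
as `∫_{[−λ,λ]} h_+(y) e^{2πity} dy`. [cite: Burnol2002CRAS, Définition 2 (TeX l.361–364)] -/
def psiPlus (lam : ℝ) (t : ℂ) : ℂ :=
  2 * Complex.cos (2 * π * lam * t) -
    ∫ y in Icc (-lam) lam, hPlus lam y * cexp (2 * π * I * t * y)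

/-- RH-FREE (definition). **Définition 2, `ψ_−^λ(t) = 2cos(2πλt) + 𝓕₊((1−F_λ)^{-1}P_λ(2cos 2πλy))(t)`**
(TeX l.365–367). [cite: Burnol2002CRAS, Définition 2 (TeX l.365–367)] -/
def psiMinus (lam : ℝ) (t : ℂ) : ℂ :=
  2 * Complex.cos (2 * π * lam * t) +
    ∫ y in Icc (-lam) lam, hMinus lam y * cexp (2 * π * I * t * y)

/-- `2cos(2πλt)` as the temperate-growth function `𝐞(λt) + 𝐞(−λt)`. [cite: Burnol2002CRAS, Définition 1 (TeX l.346–352)] -/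
theorem hasTemperateGrowth_twoChar (lam : ℝ) :
    Function.HasTemperateGrowth
      (fun t : ℝ => (((𝐞 (lam * t) : Circle) : ℂ) + ((𝐞 (-(lam * t)) : Circle) : ℂ))) := by
  have hl : Function.HasTemperateGrowth (fun t : ℝ => lam * t) :=
    (Function.HasTemperateGrowth.const lam).mul Function.HasTemperateGrowth.id'
  have h1 := Literature.NumberTheory.Weil1964.hasTemperateGrowth_fourierChar_coe.comp hl
  have h2 := Literature.NumberTheory.Weil1964.hasTemperateGrowth_fourierChar_coe.comp hl.neg
  exact h1.add h2

/-- `𝐞(λt) + 𝐞(−λt) = 2cos(2πλt)`. [cite: Burnol2002CRAS, Définition 1 (TeX l.346–352)] -/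
theorem twoChar_eq_twoCos (lam t : ℝ) :
    ((𝐞 (lam * t) : Circle) : ℂ) + ((𝐞 (-(lam * t)) : Circle) : ℂ) = twoCos lam t := by
  rw [Literature.NumberTheory.Weil1964.fourierChar_coe_eq_exp,
    Literature.NumberTheory.Weil1964.fourierChar_coe_eq_exp, twoCos, Complex.ofReal_cos,
    Complex.two_cos]
  push_cast
  ring_nf

/-- RH-FREE (definition). **Définition 1, the tempered distribution
`A_λ(t) = δ_{−λ}(t) + δ_λ(t) + 2cos(2πλt) − ((1 + 𝓕₊)(1+F_λ)^{-1}(2cos(2πλy)))(t)`** (TeX l.346–350;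
the last term is the `L²` function `h_+ + 𝓕h_+`). [cite: Burnol2002CRAS, Définition 1 (TeX l.346–350)] -/
def distA (lam : ℝ) : 𝓢'(ℝ, ℂ) :=
  TemperedDistribution.delta (-lam) + TemperedDistribution.delta lam +
    (hasTemperateGrowth_twoChar lam).toTemperedDistribution -
    MeasureTheory.Lp.toTemperedDistribution (hPlus lam + fourierL2 (hPlus lam))

/-- RH-FREE (definition). **Définition 1, the tempered distribution
`−iB_λ(t) = δ_{−λ}(t) + δ_λ(t) − 2cos(2πλt) + ((1 − 𝓕₊)(1−F_λ)^{-1}(2cos(2πλy)))(t)`** (TeX l.350–352).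
[cite: Burnol2002CRAS, Définition 1 (TeX l.350–352)] -/
def distNegIB (lam : ℝ) : 𝓢'(ℝ, ℂ) :=
  TemperedDistribution.delta (-lam) + TemperedDistribution.delta lam -
    (hasTemperateGrowth_twoChar lam).toTemperedDistribution +
    MeasureTheory.Lp.toTemperedDistribution (hMinus lam - fourierL2 (hMinus lam))

/-- RH-FREE. **Théorème 6** (TeX l.355–359), verbatim: *Les distributions paires tempérées `A_λ(t)` et
`−iB_λ(t)` ont la propriété de Sonine: elles sont nulles et de Fourier nulles dans l'intervalle
`(−λ,λ)`. Elles sont respectivement invariante et anti-invariante sous Fourier.* (Mathlib's `𝓕` on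
`𝓢'` has kernel `e^{−2πixy}`; on these even distributions it is Burnol's `𝓕`.)
[cite: Burnol2002CRAS, Théorème 6 (TeX l.355–359)] -/
def Burnol2002CRAS_thm6 : Prop :=
  ∀ lam : ℝ, 0 < lam →
    (∀ φ : 𝓢(ℝ, ℂ), tsupport φ ⊆ Ioo (-lam) lam →
      distA lam φ = 0 ∧ (𝓕 (distA lam)) φ = 0 ∧ distNegIB lam φ = 0 ∧ (𝓕 (distNegIB lam)) φ = 0) ∧
    𝓕 (distA lam) = distA lam ∧ 𝓕 (distNegIB lam) = -distNegIB lam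

/-- RH-FREE. **Théorème 7** (TeX l.369–375), verbatim: *La fonction entière paire `ψ_±^λ` est (l'unique)
fonction entière dont la restriction à `(−λ,λ)` est `(1 ± F_λ)^{-1}(2cos(2πλy))`. Elle est aussi
l'unique fonction solution de l'équation `φ(x) ± 𝓕(φ|_{(−λ,λ)})(x) = 2cos(2πλx)`. On a
`A_λ = ψ_+^λ + 𝓕(ψ_+^λ)` et `−iB_λ = −ψ_−^λ + 𝓕(ψ_−^λ)`.* Typed: (i) `ψ_±` entire and even, a.e. equal to
`h_±` on `(−λ,λ)`, unique among entire functions with that restriction; (ii) `ψ_±` solves the integral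
equation on `ℝ`, uniquely among functions integrable on `[−λ,λ]`; (iii) the two distribution identities,
tested on Schwartz functions (`𝓕(ψ)` as a tempered distribution: `⟨𝓕ψ, φ⟩ = ⟨ψ, 𝓕φ⟩`).
[cite: Burnol2002CRAS, Théorème 7 (TeX l.369–375)] -/
def Burnol2002CRAS_thm7 : Prop :=
  ∀ lam : ℝ, 0 < lam →
    (Differentiable ℂ (psiPlus lam) ∧ Differentiable ℂ (psiMinus lam) ∧
      (∀ t : ℂ, psiPlus lam (-t) = psiPlus lam t) ∧ (∀ t : ℂ, psiMinus lam (-t) = psiMinus lam t)) ∧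
    ((∀ᵐ x : ℝ, x ∈ Ioo (-lam) lam → psiPlus lam x = hPlus lam x) ∧
      (∀ᵐ x : ℝ, x ∈ Ioo (-lam) lam → psiMinus lam x = hMinus lam x) ∧
      (∀ G : ℂ → ℂ, Differentiable ℂ G → (∀ᵐ x : ℝ, x ∈ Ioo (-lam) lam → G x = hPlus lam x) →
        G = psiPlus lam) ∧
      (∀ G : ℂ → ℂ, Differentiable ℂ G → (∀ᵐ x : ℝ, x ∈ Ioo (-lam) lam → G x = hMinus lam x) →
        G = psiMinus lam)) ∧
    ((∀ x : ℝ, psiPlus lam x + ∫ y in Icc (-lam) lam, psiPlus lam y * cexp (2 * π * I * x * y) =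
        2 * Complex.cos (2 * π * lam * x)) ∧
      (∀ x : ℝ, psiMinus lam x - ∫ y in Icc (-lam) lam, psiMinus lam y * cexp (2 * π * I * x * y) =
        2 * Complex.cos (2 * π * lam * x)) ∧
      (∀ φ : ℝ → ℂ, IntegrableOn φ (Icc (-lam) lam) →
        (∀ x : ℝ, φ x + ∫ y in Icc (-lam) lam, φ y * cexp (2 * π * I * x * y) =
          2 * Complex.cos (2 * π * lam * x)) → ∀ x : ℝ, φ x = psiPlus lam x) ∧
      (∀ φ : ℝ → ℂ, IntegrableOn φ (Icc (-lam) lam) →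
        (∀ x : ℝ, φ x - ∫ y in Icc (-lam) lam, φ y * cexp (2 * π * I * x * y) =
          2 * Complex.cos (2 * π * lam * x)) → ∀ x : ℝ, φ x = psiMinus lam x)) ∧
    ((∀ φ : 𝓢(ℝ, ℂ), distA lam φ =
        (∫ t : ℝ, psiPlus lam t * φ t) + ∫ t : ℝ, psiPlus lam t * (𝓕 φ : 𝓢(ℝ, ℂ)) t) ∧
      (∀ φ : 𝓢(ℝ, ℂ), distNegIB lam φ =
        -(∫ t : ℝ, psiMinus lam t * φ t) + ∫ t : ℝ, psiMinus lam t * (𝓕 φ : 𝓢(ℝ, ℂ)) t))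

/-! ## §5. The functions `ℰ(w)`, `𝒜(w)`, `ℬ(w)` of the Sonine spaces (Thms. 8, 9) -/

/-- RH-FREE (definition). **Entire completed right Mellin transform**: `M` is entire and agrees with
`π^{−w/2}Γ(w/2) ∫₀^∞ f(t) t^{−w} dt = Γ_ℝ(w) · mellin f (1 − w)` on `Re w > 1/2` (where, for `f ∈ K_λ`
— square integrable, a.e. zero on `(0,λ)` — the integral converges absolutely and `Γ_ℝ` has no pole).
`𝒮_λ` is the space of these `M` for `f ∈ K_λ` (TeX l.236–238). Unique when it exists.
[cite: Burnol2002CRAS, §2 (TeX l.236–238)] -/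
def IsCompletedRightMellin (f : ℝ → ℂ) (M : ℂ → ℂ) : Prop :=
  Differentiable ℂ M ∧ ∀ w : ℂ, 1 / 2 < w.re → M w = Gammaℝ w * mellin f (1 - w)

/-- RH-FREE (definition). **`Z` IS the euclidean evaluator `Z_w^λ = π^{−w/2}Γ(w/2) X_w^λ ∈ K_λ`**
(TeX l.401–404 and Thm. 9: `∀ f ∈ K_λ, ∫₀^∞ f(t) t^{−w} dt = ∫₀^∞ f(t) X_w(t) dt`, "pour `Re(w) ≤ 1/2`
la première intégrale est un prolongement analytique"): `Z ∈ K_λ` and `∫₀^∞ f Z = M_f(w)` for every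
`f ∈ K_λ` with entire completed transform `M_f`. (This is Burnol 2004's `Z^λ_{w,0}`.)
[cite: Burnol2002CRAS, Théorème 9 (TeX l.424–428)] -/
def IsSonineZ (lam : ℝ) (w : ℂ) (Z : Lp ℂ 2 (volume : Measure ℝ)) : Prop :=
  Z ∈ sonineK lam ∧ ∀ f : Lp ℂ 2 (volume : Measure ℝ), f ∈ sonineK lam → ∀ M : ℂ → ℂ,
    IsCompletedRightMellin f M → ∫ t in Ioi (0 : ℝ), f t * Z t = M w

/-- RH-FREE (definition). **The printed formula for `ℰ_λ(w)` on `Re w > 0`** (Thm. 8, TeX l.383–386):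
`ℰ_λ(w) = π^{−w/2}Γ(w/2) (λ^{1/2−w} + (√λ/2) ∫_λ^∞ (ψ_+^λ(t) − ψ_−^λ(t)) t^{−w} dt)` ("L'intégrale est
absolument convergente pour `Re(w) > 0`"; Bochner integral, junk elsewhere — `IsSonineE` carries the
entire continuation). [cite: Burnol2002CRAS, Théorème 8 (TeX l.383–386)] -/
def sonineEFormula (lam : ℝ) (w : ℂ) : ℂ :=
  Gammaℝ w * ((lam : ℂ) ^ (1 / 2 - w) +
    (Real.sqrt lam : ℂ) / 2 * ∫ t in Ioi lam, (psiPlus lam t - psiMinus lam t) * (t : ℂ) ^ (-w))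

/-- RH-FREE (definition). `E` IS `ℰ_λ`: the entire function agreeing with the printed formula on
`Re w > 0` ("La fonction `ℰ_λ(w)` est une fonction entière", TeX l.387). [cite: Burnol2002CRAS, Théorème 8 (TeX l.383–391)] -/
def IsSonineE (lam : ℝ) (E : ℂ → ℂ) : Prop :=
  Differentiable ℂ E ∧ ∀ w : ℂ, 0 < w.re → E w = sonineEFormula lam w

/-- RH-FREE (definition). Transport from the critical line to the real axis: `F ↦ (z ↦ F(1/2 − iz))`
(`Im z > 0 ↔ Re(1/2 − iz) > 1/2`; the reflection `w ↦ w^# = 1 − w̄` becomes `z ↦ z̄`), used to read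
Burnol's "condition de de Branges pour le demi-plan `Re(s) > 1/2`" and `ℬ(ℰ)` (§1, TeX l.126–150)
through the tree's upper-half-plane vocabulary. [cite: Burnol2002CRAS, §1 (TeX l.126–150)] -/
def toUpperHalfPlane (F : ℂ → ℂ) (z : ℂ) : ℂ :=
  F (1 / 2 - I * z)

/-- RH-FREE. **Théorème 8** (TeX l.381–391), verbatim: *Soit
`ℰ_λ(w) = π^{−w/2}Γ(w/2)(λ^{1/2−w} + (√λ/2)∫_λ^∞ (ψ_+^λ(t) − ψ_−^λ(t)) t^{−w} dt)`. L'intégrale est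
absolument convergente pour `Re(w) > 0`. La fonction `ℰ_λ(w)` est une fonction entière satisfaisant la
condition de de Branges pour le demi-plan `Re(s) > 1/2` et l'espace `ℬ(ℰ_λ)` coïncide (isométriquement)
avec l'espace `𝒮_λ` des transformées de Mellin complétées des fonctions de `K_λ`.* Typed (λ > 0):
(i) absolute convergence on `Re w > 0`; (ii) an entire `ℰ_λ` with the printed values exists; for every
such `ℰ = ℰ_λ` and `E(z) := ℰ(1/2 − iz)`: (iii) `E` is Hermite–Biehler (`|ℰ(w)| > |ℰ(w^#)|` on
`Re w > 1/2`); (iv) for every `f ∈ K_λ` with completed transform `M_f`, `F(z) := M_f(1/2 − iz)` lies in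
`𝓗(E)` (de Branges' membership: entire, `∫|F/E|² < ∞` on `ℝ`, `|F(z)|² ≤ ‖F‖²K(z,z)`) with
`‖F‖²_{𝓗(E)} = ∫_ℝ |M_f/ℰ|²(1/2+iτ) dτ = 2π·∫₀^∞|f|² = π ‖f‖²_{L²(ℝ)}` (Burnol: `ℬ`-norm with `|ds|/2π`,
`‖f‖² = ∫₀^∞|f|²`); (v) conversely every element of `𝓗(E)` is such an `F`.
[cite: Burnol2002CRAS, Théorème 8 (TeX l.381–391)] -/
def Burnol2002CRAS_thm8 : Prop :=
  ∀ lam : ℝ, 0 < lam →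
    (∀ w : ℂ, 0 < w.re →
      IntegrableOn (fun t : ℝ => (psiPlus lam t - psiMinus lam t) * (t : ℂ) ^ (-w)) (Ioi lam)) ∧
    (∃ E : ℂ → ℂ, IsSonineE lam E) ∧
    ∀ E : ℂ → ℂ, IsSonineE lam E →
      IsHermiteBiehler (toUpperHalfPlane E) ∧
      (∀ f : Lp ℂ 2 (volume : Measure ℝ), f ∈ sonineK lam → ∀ M : ℂ → ℂ,
        IsCompletedRightMellin f M →
          Differentiable ℂ (toUpperHalfPlane M) ∧
          Integrable (fun x : ℝ => ‖toUpperHalfPlane M x / toUpperHalfPlane E x‖ ^ 2) ∧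
          HasKernelBound (toUpperHalfPlane E) (toUpperHalfPlane M) ∧
          deBrangesNormSq (toUpperHalfPlane E) (toUpperHalfPlane M) = π * ‖f‖ ^ 2) ∧
      (∀ F : ℂ → ℂ, Differentiable ℂ F →
        Integrable (fun x : ℝ => ‖F x / toUpperHalfPlane E x‖ ^ 2) →
        HasKernelBound (toUpperHalfPlane E) F →
          ∃ f : Lp ℂ 2 (volume : Measure ℝ), f ∈ sonineK lam ∧ ∃ M : ℂ → ℂ,
            IsCompletedRightMellin f M ∧ F = toUpperHalfPlane M)

/-- RH-FREE. **Théorème 9** (TeX l.424–428), verbatim: *Il y a coïncidence entre `ℰ_λ(w)` et `√λ` fois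
la valeur du « saut » de l'évaluateur (« euclidien ») `Z_w^λ(t) = π^{−w/2}Γ(w/2)X_w^λ(t)` en `t = λ`.*
(`X_w^λ ∈ K_λ` vanishes on `(0,λ)` and "`X_w^λ(t) − t^{−w}` est la restriction à `t > λ` d'une fonction
entière", TeX l.404–407, so `Z_w^λ` has a continuous representative on `(λ,∞)` with a right limit at
`λ`; the jump is that limit.) Typed: for every `w` and every evaluator `Z = Z_w^λ`, there is a function
`g` continuous on `(λ,∞)`, a.e. equal to `Z` there, with a right limit `c` at `λ`, and
`ℰ_λ(w) = √λ · c`. [cite: Burnol2002CRAS, Théorème 9 (TeX l.424–428)] -/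
def Burnol2002CRAS_thm9 : Prop :=
  ∀ lam : ℝ, 0 < lam → ∀ E : ℂ → ℂ, IsSonineE lam E →
    ∀ (w : ℂ) (Z : Lp ℂ 2 (volume : Measure ℝ)), IsSonineZ lam w Z →
      ∃ (g : ℝ → ℂ) (c : ℂ), ContinuousOn g (Ioi lam) ∧ (∀ᵐ t : ℝ, t ∈ Ioi lam → Z t = g t) ∧
        Tendsto g (𝓝[>] lam) (𝓝 c) ∧ E w = (Real.sqrt lam : ℂ) * c

end Burnol2002

end Literature.Analysis.DeBrangesSpaces
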